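import Summits.BirchSwinnertonDyer.BirchSwinnertonDyer.Theorems.ThetaPartnerAtTwoSignedMainConjectureCMTwoRankZeroFlatTwistFamilySiblings
import HarnessLib

/-!
# Route `ThetaPartnerAtTwo`, crux K2r0P `SignedMainConjectureCMTwoRankZeroOfPub` (stmt-BirchSwinnertonDyer-24945),
# line `rankzero` v14/v15, stub (μ♭)_A: the family node for PRIME-POWER conductor `p^k` FROM PRINT — one real and one
# imaginary UNIT-ZONE rank-`0` sibling per anchor (the `j = −2¹⁵·3·5³` family of `27a`, `N = 27·d²`)

Cell `bsd-wall`, width seat `bsd-wall-tp2-p2-w4` (g7). THEOREMS ONLY (no `def`, no named fact, no `sorry`); helper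
`--supports` the crux; sequel of `…FlatTwistFamilySiblings` (namespace `…Theorems.FlatTwist.Family`), whose
`analyticMuFlat_of_j_eq_of_both_certificates` is the family node for an anchor pair `(W, W′ = W^{(±p)})` of conductor `p^k`
(not necessarily a square) asking BOTH the plus and the minus certificate at each anchor. Here both are supplied FROM PRINT
by unit-zone siblings of the two signs:

* §1 `unitZone_certificate_of_sibling` — a CM rank-`0` good-supersingular sibling `A₁ = C₁ • W^{(d₁)}` (`d₁` square-free,
  `p ∤ d₁`) with `2 ∤ #Ш(A₁)·∏c_ℓ(A₁)` carries the plus certificate (`FlatTwist.exists_odd_of_unitZone`, granted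
  `hBF hLrat hGZK` and the period unit from Abbes–Ullmo; `a₂(A₁) = 0` by the twisting formula);
  `both_certificates_of_unitZone_siblings` — a REAL (`d > 0`; `d = 1` admissible, `C • W = W^{(1)}` by
  `exists_variableChange_quadraticTwist_one`) and an IMAGINARY (`d < 0`) such sibling give the plus AND the minus certificate
  at `W` (`certificates_of_sibling`);
* §2 `analyticMuFlat_family_of_pub_of_unitZone_siblings_primePower` — THE FAMILY NODE FROM PRINT for `N_W = N_{W′} = p^k`:
  anchor pair plus four unit-zone siblings (real/imaginary for `W`, real/imaginary for `W′`) ⟹ the registered stub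
  `stub_analyticMuFlatNonUnitCMTwo` RESTRICTED TO THE FAMILY `j(A) = j(W)`, granted `hBF hmod hLrat hGZK hAU`.

Census reading (`Cruxes/SignedMainConjectureCMTwoRankZeroOfPub/FLAT-CENSUS-CM-RANK0-TABLE-v1.md`, not asserted): the
`j = −2¹⁵·3·5³` curves (CM by the order of discriminant `−27`) are the square-free twists of the `j ≠ 0` members of `27a`
(`N = 27 = 3³`, UNIT zone, analytic rank `0` — the real sibling with `d = 1`) and `1323b = 27·7²` (UNIT zone, rank `0`, the
imaginary sibling `d = −7`); `W′ = W^{(−3)}` is `3`-isogenous to `W` (same classes serve). So FLAT on this sixth non-`j = 0`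
family costs print plus the parity of `#Ш·∏c` of four LMFDB curves. Nothing about any particular curve is asserted; (μ♭)
class-wide stays open (the `j = 0` tail); BSD is not proved by any of this.

References: Burungale–Flach, Camb. J. Math. (2024) Thm. 1.1 [BurungaleFlach2024]; Silverman *AEC* (2009) X.5 Prop. 5.4
[SilvermanAEC2009]; Barrios–Roy–Sahajpal–Tallana–Tobin–Wiersema, Res. Number Theory 11 (2025) Thm. 5.1 [BarriosEtAl2025];
Mazur–Tate–Teitelbaum, Invent. Math. 84 (1986) §I.8 [MazurTateTeitelbaum1986Invent]; Pal, Proc. AMS 140 (2012) Thm. 3.2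
[Pal2012]; Abbes–Ullmo, Compositio Math. 103 (1996) Thm. A [AbbesUllmo1996]; Pollack, Duke Math. J. 118 (2003) Prop. 6.18
[Pollack2003].
-/

set_option autoImplicit false
-- the Theorems namespace of this sub repeats the summit name by design (D-0017 nested layout)
set_option linter.dupNamespace false

noncomputable section

open scoped Classical MatrixGroups ModularForm NumberField NumberTheorySymbols

open NumberField IsDedekindDomain Rat.HeightOneSpectrum CongruenceSubgroup
  Literature.NumberTheory.EllipticCurves Literature.NumberTheory.GaloisRepresentations
  WeierstrassCurve Literature.NumberTheory.EllipticCurves.ModularForms Literature.NumberTheory.EllipticCurves.Rank1Residual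
  Literature.NumberTheory.EllipticCurves.Rank1Residual.Typed
  Summit.BirchSwinnertonDyer.Rank1Residual Summit.BirchSwinnertonDyer.Rank1Residual.Supersingular

namespace Summit.BirchSwinnertonDyer.BirchSwinnertonDyer.Theorems.FlatTwist.Family

/-! ## §1. Plus certificates at unit-zone siblings; both certificates at the anchor -/

section Sibling

variable {p k : ℕ} (W : WeierstrassCurve ℚ) [W.IsElliptic] [W.IsGloballyMinimal] [NeZero (W.conductorNorm ℤ)]
  {fW : CuspForm (Gamma0 (W.conductorNorm ℤ)) 2}
  {d₁ : ℤ} {A₁ : WeierstrassCurve ℚ} [A₁.IsElliptic] [A₁.IsGloballyMinimal] [NeZero (A₁.conductorNorm ℤ)]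
  {f₁ : CuspForm (Gamma0 (A₁.conductorNorm ℤ)) 2}
  {d₂ : ℤ} {A₂ : WeierstrassCurve ℚ} [A₂.IsElliptic] [A₂.IsGloballyMinimal] [NeZero (A₂.conductorNorm ℤ)]

omit [NeZero (W.conductorNorm ℤ)] in
/-- **UNIT-ZONE CERTIFICATE AT A SIBLING.** Anchor `W` (globally minimal, good supersingular at `2`, `a₂(W) = 0`, conductor `p^k`);
sibling `A₁ = C₁ • W^{(d₁)}` globally minimal, `d₁` square-free with `p ∤ d₁`, CM, of analytic rank `0`, good supersingular at
`2`, IN THE UNIT ZONE (`2 ∤ #Ш(A₁)·∏c_ℓ(A₁)`), newform `f₁`. Granted `hBF hLrat hGZK` and Abbes–Ullmo: some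
`[b/4^k]⁺_{f₁} − [0]⁺_{f₁}` (`k ≥ 1`, `b` odd) is half an odd integer (`FlatTwist.exists_odd_of_unitZone`; `a₂(A₁) = ±a₂(W) = 0`
by the twisting formula at the good prime `2 ∤ d₁`, `d₁ ≡ 1 (mod 4)` by `emod_four_eq_one_of_hasGoodReductionAtPrime_two`).
[cite: BurungaleFlach2024, Thm. 1.1] [cite: AbbesUllmo1996, Thm. A] [cite: MazurTateTeitelbaum1986Invent, §I.4 (4.2), §I.8] -/
theorem unitZone_certificate_of_sibling
    (hBF : bsdTriple_of_hasCM_of_L_one_ne_zero) (hmod : exists_isNewformOf) (hLrat : hasEntireLFunction_rat)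
    (hGZK : rank_eq_analyticRank_of_analyticRank_le_one) (hAU : abbesUllmo_not_dvd_maninConstant_of_not_dvd_level)
    (hp : p.Prime) (hNW : W.conductorNorm ℤ = p ^ k) (hss : GoodSS W 2) (haW : W.frobeniusTrace 2 = 0)
    (hsq₁ : Squarefree d₁) (hpd₁ : ¬ (p : ℤ) ∣ d₁) {C₁ : VariableChange ℚ} (hA₁ : C₁ • W.quadraticTwist (d₁ : ℚ) = A₁)
    (hcm₁ : A₁.HasCM) (hr₁ : A₁.analyticRank = 0) (hss₁ : GoodSS A₁ 2)
    (hunit₁ : ¬ 2 ∣ A₁.shaOrder * A₁.tamagawaProduct) (hf₁ : IsNewformOf A₁ f₁) :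
    ∃ k : ℕ, 1 ≤ k ∧ ∃ b : ℤ, Odd b ∧ ∃ m : ℤ, Odd m ∧
      ratPlusSymbol f₁ ((b : ℚ) / 4 ^ k) = ratPlusSymbol f₁ 0 + (m : ℚ) / 2 := by
  have h2 := SkinnerUrban2014.realPeriodRat_eq_unit_mul_plusPeriod_two_fact_of_abbesUllmo hAU
  have hcop₁ : IsCoprime d₁ (W.conductorNorm ℤ : ℤ) := isCoprime_natCast_of_not_dvd_of_eq_pow hp hpd₁ hNW
  have hd4 : d₁ % 4 = 1 := emod_four_eq_one_of_hasGoodReductionAtPrime_two W hsq₁ hA₁ hss.1 hss₁.1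
  have h2d₁ : ¬ (2 : ℤ) ∣ d₁ := by omega
  have ha₁ : A₁.frobeniusTrace 2 = 0 := by
    rw [(hasGoodReductionAtPrime_twist_and_frobeniusTrace_eq W 2 hmod hd4 hsq₁ hcop₁ hA₁ hss.1 h2d₁).2, haW, mul_zero]
  exact FlatTwist.exists_odd_of_unitZone A₁ hBF hLrat hGZK h2 hcm₁ hr₁ hss₁ ha₁ hunit₁ hf₁

/-- **BOTH CERTIFICATES AT THE ANCHOR FROM A REAL AND AN IMAGINARY UNIT-ZONE SIBLING.** Anchor `W` (globally minimal, good
supersingular at `2`, `a₂(W) = 0`, `Δ(W) < 0`, conductor `p^k`, newform `f_W`); a REAL sibling `A₁ = C₁ • W^{(d₁)}`, `d₁ > 0`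
(`d₁ = 1` admissible), and an IMAGINARY sibling `A₂ = C₂ • W^{(d₂)}`, `d₂ < 0`, both as in `unitZone_certificate_of_sibling`.
Granted `hBF hmod hLrat hGZK hAU`: the plus certificate AND the minus certificate hold at `f_W` (`certificates_of_sibling`).
[cite: BurungaleFlach2024, Thm. 1.1] [cite: MazurTateTeitelbaum1986Invent, §I.8] [cite: Pal2012, Thm. 3.2] [cite: AbbesUllmo1996, Thm. A] -/
theorem both_certificates_of_unitZone_siblings
    (hBF : bsdTriple_of_hasCM_of_L_one_ne_zero) (hmod : exists_isNewformOf) (hLrat : hasEntireLFunction_rat)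
    (hGZK : rank_eq_analyticRank_of_analyticRank_le_one) (hAU : abbesUllmo_not_dvd_maninConstant_of_not_dvd_level)
    (hp : p.Prime) (hNW : W.conductorNorm ℤ = p ^ k) (hss : GoodSS W 2) (haW : W.frobeniusTrace 2 = 0) (hΔ : W.Δ < 0)
    (hfW : IsNewformOf W fW)
    (hd₁ : 0 < d₁) (hsq₁ : Squarefree d₁) (hpd₁ : ¬ (p : ℤ) ∣ d₁) {C₁ : VariableChange ℚ}
    (hA₁ : C₁ • W.quadraticTwist (d₁ : ℚ) = A₁) (hcm₁ : A₁.HasCM) (hr₁ : A₁.analyticRank = 0) (hss₁ : GoodSS A₁ 2)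
    (hunit₁ : ¬ 2 ∣ A₁.shaOrder * A₁.tamagawaProduct)
    (hd₂ : d₂ < 0) (hsq₂ : Squarefree d₂) (hpd₂ : ¬ (p : ℤ) ∣ d₂) {C₂ : VariableChange ℚ}
    (hA₂ : C₂ • W.quadraticTwist (d₂ : ℚ) = A₂) (hcm₂ : A₂.HasCM) (hr₂ : A₂.analyticRank = 0) (hss₂ : GoodSS A₂ 2)
    (hunit₂ : ¬ 2 ∣ A₂.shaOrder * A₂.tamagawaProduct) :
    (∃ k : ℕ, 1 ≤ k ∧ ∃ b : ℤ, Odd b ∧ ∃ m : ℤ, Odd m ∧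
        ratPlusSymbol fW ((b : ℚ) / 4 ^ k) = ratPlusSymbol fW 0 + (m : ℚ) / 2) ∧
      (∃ k : ℕ, 1 ≤ k ∧ ∃ b : ℤ, Odd b ∧ ∃ m : ℤ, Odd m ∧ 2 * ratMinusSymbol fW ((b : ℚ) / 4 ^ k) = m) := by
  have hcop₁ : IsCoprime d₁ (W.conductorNorm ℤ : ℤ) := isCoprime_natCast_of_not_dvd_of_eq_pow hp hpd₁ hNW
  have hcop₂ : IsCoprime d₂ (W.conductorNorm ℤ : ℤ) := isCoprime_natCast_of_not_dvd_of_eq_pow hp hpd₂ hNW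
  obtain ⟨f₁, hf₁⟩ := hmod A₁
  obtain ⟨f₂, hf₂⟩ := hmod A₂
  have hres₁ := unitZone_certificate_of_sibling W hBF hmod hLrat hGZK hAU hp hNW hss haW hsq₁ hpd₁ hA₁ hcm₁ hr₁ hss₁
    hunit₁ hf₁
  have hres₂ := unitZone_certificate_of_sibling W hBF hmod hLrat hGZK hAU hp hNW hss haW hsq₂ hpd₂ hA₂ hcm₂ hr₂ hss₂
    hunit₂ hf₂
  exact ⟨(certificates_of_sibling W hmod hAU hss hΔ hfW hsq₁ hcop₁ hA₁ hss₁.1 hf₁ hres₁).1 hd₁,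
    (certificates_of_sibling W hmod hAU hss hΔ hfW hsq₂ hcop₂ hA₂ hss₂.1 hf₂ hres₂).2 hd₂⟩

end Sibling

/-! ## §2. The family node for conductor `p^k` from print and four unit-zone siblings -/

section Family

variable {p k : ℕ} (W W' : WeierstrassCurve ℚ) [W.IsElliptic] [W.IsGloballyMinimal] [W'.IsElliptic] [W'.IsGloballyMinimal]
  [NeZero (W.conductorNorm ℤ)] [NeZero (W'.conductorNorm ℤ)]
  {d₁ : ℤ} {A₁ : WeierstrassCurve ℚ} [A₁.IsElliptic] [A₁.IsGloballyMinimal] [NeZero (A₁.conductorNorm ℤ)]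
  {d₂ : ℤ} {A₂ : WeierstrassCurve ℚ} [A₂.IsElliptic] [A₂.IsGloballyMinimal] [NeZero (A₂.conductorNorm ℤ)]
  {d₃ : ℤ} {A₃ : WeierstrassCurve ℚ} [A₃.IsElliptic] [A₃.IsGloballyMinimal] [NeZero (A₃.conductorNorm ℤ)]
  {d₄ : ℤ} {A₄ : WeierstrassCurve ℚ} [A₄.IsElliptic] [A₄.IsGloballyMinimal] [NeZero (A₄.conductorNorm ℤ)]

/-- **FLAT ON A WHOLE `j`-FAMILY OF PRIME-POWER CONDUCTOR ANCHORS, FROM PRINT AND FOUR UNIT-ZONE MEMBERS.** Grant BY NAME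
`hBF hmod hLrat hGZK hAU`. Anchor pair `W`, `W′ = C′ • W^{(q)}` (`q = ±p`, `p` prime): globally minimal, good supersingular at
`2` with `a₂ = 0`, `Δ < 0`, conductor `p^k`, `j(W) ≠ 0, 1728`. UNIT-ZONE SIBLINGS, all globally minimal, CM, of analytic rank
`0`, good supersingular at `2`, square-free parameter prime to `p`, `2 ∤ #Ш·∏c_ℓ`: a real one `A₁ = C₁ • W^{(d₁)}` (`d₁ > 0`)
and an imaginary one `A₂ = C₂ • W^{(d₂)}` (`d₂ < 0`) for `W`, likewise `A₃` (`d₃ > 0`), `A₄` (`d₄ < 0`) for `W′`. THEN the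
registered stub `stub_analyticMuFlatNonUnitCMTwo` (= FLAT) holds RESTRICTED TO THE FAMILY `j(A) = j(W)` — its binders verbatim
after `A.j = W.j →` (`analyticMuFlat_of_j_eq_of_both_certificates` fed with `both_certificates_of_unitZone_siblings`).
Nothing about any particular curve is asserted; BSD is not proved by this. [cite: BurungaleFlach2024, Thm. 1.1]
[cite: SilvermanAEC2009, X.5 Prop. 5.4] [cite: BarriosEtAl2025, Thm. 5.1, rows I₀] [cite: AbbesUllmo1996, Thm. A]
[cite: Pollack2003, Prop. 6.18] -/
theorem analyticMuFlat_family_of_pub_of_unitZone_siblings_primePower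
    (hBF : bsdTriple_of_hasCM_of_L_one_ne_zero) (hmod : nonempty_modularParametrizationData)
    (hLrat : hasEntireLFunction_rat) (hGZK : rank_eq_analyticRank_of_analyticRank_le_one)
    (hAU : abbesUllmo_not_dvd_maninConstant_of_not_dvd_level) (hp : p.Prime) {q : ℤ} (hq : q = p ∨ q = -(p : ℤ))
    (hss : GoodSS W 2) (haW : W.frobeniusTrace 2 = 0) (hΔ : W.Δ < 0) (hj0 : W.j ≠ 0) (hj1728 : W.j ≠ 1728)
    (hNW : W.conductorNorm ℤ = p ^ k)
    (hd₁ : 0 < d₁) (hsq₁ : Squarefree d₁) (hpd₁ : ¬ (p : ℤ) ∣ d₁) {C₁ : VariableChange ℚ}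
    (hA₁ : C₁ • W.quadraticTwist (d₁ : ℚ) = A₁) (hcm₁ : A₁.HasCM) (hr₁ : A₁.analyticRank = 0) (hss₁ : GoodSS A₁ 2)
    (hunit₁ : ¬ 2 ∣ A₁.shaOrder * A₁.tamagawaProduct)
    (hd₂ : d₂ < 0) (hsq₂ : Squarefree d₂) (hpd₂ : ¬ (p : ℤ) ∣ d₂) {C₂ : VariableChange ℚ}
    (hA₂ : C₂ • W.quadraticTwist (d₂ : ℚ) = A₂) (hcm₂ : A₂.HasCM) (hr₂ : A₂.analyticRank = 0) (hss₂ : GoodSS A₂ 2)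
    (hunit₂ : ¬ 2 ∣ A₂.shaOrder * A₂.tamagawaProduct)
    {C' : VariableChange ℚ} (hW' : C' • W.quadraticTwist (q : ℚ) = W')
    (hss' : GoodSS W' 2) (haW' : W'.frobeniusTrace 2 = 0) (hΔ' : W'.Δ < 0) (hNW' : W'.conductorNorm ℤ = p ^ k)
    (hd₃ : 0 < d₃) (hsq₃ : Squarefree d₃) (hpd₃ : ¬ (p : ℤ) ∣ d₃) {C₃ : VariableChange ℚ}
    (hA₃ : C₃ • W'.quadraticTwist (d₃ : ℚ) = A₃) (hcm₃ : A₃.HasCM) (hr₃ : A₃.analyticRank = 0) (hss₃ : GoodSS A₃ 2)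
    (hunit₃ : ¬ 2 ∣ A₃.shaOrder * A₃.tamagawaProduct)
    (hd₄ : d₄ < 0) (hsq₄ : Squarefree d₄) (hpd₄ : ¬ (p : ℤ) ∣ d₄) {C₄ : VariableChange ℚ}
    (hA₄ : C₄ • W'.quadraticTwist (d₄ : ℚ) = A₄) (hcm₄ : A₄.HasCM) (hr₄ : A₄.analyticRank = 0) (hss₄ : GoodSS A₄ 2)
    (hunit₄ : ¬ 2 ∣ A₄.shaOrder * A₄.tamagawaProduct) :
    ∀ (A : WeierstrassCurve ℚ) [A.IsElliptic] [A.IsGloballyMinimal], A.j = W.j → A.HasCM → A.analyticRank = 0 →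
      GoodSS A 2 → A.frobeniusTrace 2 = 0 → 2 ∣ A.shaOrder * A.tamagawaProduct →
      ∀ [NeZero (A.conductorNorm ℤ)] (f : CuspForm (Gamma0 (A.conductorNorm ℤ)) 2), IsNewformOf A f →
        ∀ (Lplus Lminus : IwasawaAlgebra 2), IsPollackPair f 2 Lplus Lminus →
          ∃ n : ℕ, IsUnit (PowerSeries.coeff n (kobayashiL 1 Lplus Lminus)) := by
  intro A _ _ hjA _ hrA hssA _ _ _ f hf Lplus Lminus hPP
  have hmod' : exists_isNewformOf := exists_isNewformOf_of_nonempty_modularParametrizationData hmod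
  have hLA : A.entireLFunction 1 ≠ 0 := (A.analyticRank_eq_zero_iff_holds (hLrat A)).mp hrA
  obtain ⟨fW, hfW⟩ := hmod' W
  obtain ⟨fW', hfW'⟩ := hmod' W'
  obtain ⟨hWp, hWm⟩ := both_certificates_of_unitZone_siblings W hBF hmod' hLrat hGZK hAU hp hNW hss haW hΔ hfW hd₁ hsq₁
    hpd₁ hA₁ hcm₁ hr₁ hss₁ hunit₁ hd₂ hsq₂ hpd₂ hA₂ hcm₂ hr₂ hss₂ hunit₂
  obtain ⟨hW'p, hW'm⟩ := both_certificates_of_unitZone_siblings W' hBF hmod' hLrat hGZK hAU hp hNW' hss' haW' hΔ' hfW'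
    hd₃ hsq₃ hpd₃ hA₃ hcm₃ hr₃ hss₃ hunit₃ hd₄ hsq₄ hpd₄ hA₄ hcm₄ hr₄ hss₄ hunit₄
  exact analyticMuFlat_of_j_eq_of_both_certificates W W' hmod' hAU hp hq hss haW hΔ hj0 hj1728 hNW hfW hWp hWm hW' hss'
    haW' hΔ' hNW' hfW' hW'p hW'm hjA hssA.1 hf hLA Lplus Lminus hPP

end Family

end Summit.BirchSwinnertonDyer.BirchSwinnertonDyer.Theorems.FlatTwist.Family

end
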